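/-
Origin: expansion seat `prover-pub-hodgecm-own-htheta-g2-0`, handover #H14 2026-08-21T06:20Z md5 8b951fb45d98 (173 l.; NEW additive KERNEL leaf beside E, on the ROUTED ASK of pub-hodgecm2 own-b01 (INBOX l.138 (1); lead 1-g87 routing STATUS l.15420 ∕ INBOX l.141); imports LANDED `HodgeCM.Model.LiuDictionary` ONLY — NO RUN-72 dependency, install anywhere, drop alone; ns HodgeCM.Model.LiuCMSide + HodgeCM.Model; 1 predicate with parameters `LiuCMSide.IsSubCorner` (sibling of binder-2's `LiuCMSide.IsCorner`; NOT a hypothesis kind of E), 1 data def `commonReflexInputOfSubCorner` (+ `_A` rfl), 5 theorems; 0 records, nothing cited anew: THE JUNCTION'S CM-SIDE CLAUSE AT A SUB-CORNER — `IsSubCorner C K Ψ σ := ∃ (M' : CMField) (Φ' : CMType M') (e₁ : M' →+* K) (e₂ : M' →+* C.M), (Ψ = Φ'^K along e₁) ∧ (C.ΦA = Φ'^{C.M} along e₂) ∧ σ ∘ e₁ = C.τ ∘ e₂` (the data of a `CommonReflexInput` minus the abelian variety; at a FACE of a Galois sextic the corner type is induced from the imaginary quadratic subfield and only the SUB-corner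 holds — pub-hodgecm2 p251194 `Face.psi_exists_eq_inducedCMType`); `isSubCorner_of_isCorner`; `isSubCorner_of_embedding` (own-b01's proposed shape `∃ e : C.K' →+* K, …` ⇒ the sub-corner given `C.K'` a CM number field + `C.Φ'` a CM type — both true for admissible records: reflex field CM = tree `CMGaloisSubfield.isCMField_reflexField` (NOT yet vendored), reflex type CM = #H13); `exists_commonReflexInput_of_isSubCorner` (binder-2's `exists_commonReflexInput_of_isCorner` conclusion verbatim from the weaker hypothesis); `subset_span_of_block_of_isSubCorner` (#H7's `subset_span_of_block` — row 9 from ONE block + `Thm418C` — with clause 2 weakened to `∀ d, T.adm μ d → d.IsSubCorner K Ψ σ`, same conclusion) and `subset_Uiso_of_block_of_isSubCorner` (straight into `Uiso Γ K Ψ σ` under `σ ∈ Ψ`, `hR`); NAMES for audit: HodgeCM.Model.LiuCMSide.isSubCorner_of_isCorner · HodgeCM.Model.LiuCMSide.exists_commonReflexInput_of_isSubCorner · HodgeCM.Model.subset_Uiso_of_block_of_isSubCorner) (`HOME/pub-hodgecm-own-htheta/stage73/HodgeCM/Model/LiuCMSideSubCorner.lean`, md5 8b951fb45d98, 173 lin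es);
landed by the gen-31 packager (p-g31) in gate run 73 as `HodgeCM/Model/LiuCMSideSubCorner.lean` (verbatim).
-/
/-
Copyright (c) 2026 the pub-hodgecm formalisation cell (harness21).  New file, not vendored.
Origin: ROW-9 OWNER seat `prover-pub-hodgecm-own-htheta-g2-0` (unit pub-hodgecm-own-htheta, gen 2; named single owner of binder row 9
`hΘ` = the (J-Liu-Θ) junction), 2026-08-21, on the ROUTED ASK of pub-hodgecm2 own-b01 (stage-2 junction B01; pub-hodgecm INBOX l.138 (1),
lead 1-g87 routing STATUS l.15420 ∕ INBOX l.141).  Target in PKG: `HodgeCM/Model/LiuCMSideSubCorner.lean` (NEW additive KERNEL leaf beside E;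
imports the landed `Model/LiuDictionary` (RUN 62+) only; nothing imports it; drop alone on bounce).  KERNEL ONLY: 1 predicate (`def … : Prop`
WITH parameters, sibling of binder-2's `LiuCMSide.IsCorner`), 1 data def, theorems; nothing cited anew, no new hypothesis kind of E.  Nothing
here is a claim of the manuscripts under adjudication.

WHAT IT IS — THE JUNCTION'S CM-SIDE CLAUSE AT A SUB-CORNER.  The (J-Liu-Θ) junction's clause 2 (`hcorner` of axioms-1's
`subset_span_of_liuDictionary`, of this seat's single-block `subset_span_of_block`, #H7) asks every admissible CM record `d` to MATCH the corner
`(K, Ψ, σ)` by an ISOMORPHISM `e : K ≃+* d.K'` (`LiuCMSide.IsCorner`, binder-2) — true at PerL's scope because the corner type of a primitive sextic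
is primitive, so the reflex field of its lift IS `K` (binder-1 RF1, `isCorner_of_scope`).  At a FACE of a Galois sextic (stage 2, B01) the corner
type is INDUCED from the imaginary quadratic subfield (pub-hodgecm2 tree theorem `Face.psi_exists_eq_inducedCMType`, p251194), its reflex field is
that quadratic field, and `IsCorner` FAILS.  What the junction actually needs is weaker: that `Ψ` and the record's type `Φ_A` be inflated from ONE
CM pair compatibly with `σ` ∕ `τ` — the data of a `CommonReflexInput`.  This file types that as `LiuCMSide.IsSubCorner` and re-runs the row-9
sockets on it:
* `LiuCMSide.IsSubCorner C K Ψ σ := ∃ (M' : CMField) (Φ' : CMType M') (e₁ : M' →+* K) (e₂ : M' →+* C.M), (Ψ = Φ'^K along e₁) ∧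
  (C.ΦA = Φ'^{C.M} along e₂) ∧ σ ∘ e₁ = C.τ ∘ e₂`; `isSubCorner_of_isCorner` (the corner is the case `M' := K`, `e₁ := id`, `e₂ := C.k ∘ e`);
* `LiuCMSide.isSubCorner_of_embedding` — own-b01's proposed shape (`∃ e : C.K' →+* K, …`) ⇒ the sub-corner, given that `C.K'` is a CM number field and
  `C.Φ'` a CM type (both true for admissible records: reflex field CM — tree `isCMField_reflexField`, to be vendored; reflex type CM — #H13);
* `LiuCMSide.commonReflexInputOfSubCorner` ∕ `exists_commonReflexInput_of_isSubCorner` — binder-2's `exists_commonReflexInput_of_isCorner` verbatim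
  in conclusion (`∃ D : CommonReflexInput K Ψ σ, D.A = C.A ∧ ∀ Γ f, (f^*)_ℂ C.α ∈ D.surfaceClasses … V Γ`), from the sub-corner;
* `subset_span_of_block_of_isSubCorner` — #H7's `subset_span_of_block` (row 9 from ONE block and `Thm418C` alone) with clause 2 WEAKENED to
  `∀ d, T.adm μ d → d.IsSubCorner K Ψ σ`, same conclusion; `subset_Uiso_of_block_of_isSubCorner` — straight into E's `Uiso Γ K Ψ σ` (`σ ∈ Ψ`, `hR`).
NOT HERE (needs tree facts not yet vendored in PKG — `ReflexPair.reflexField_reflexType_le`, `typeLift_reflexType_reflexType`,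
`CMGaloisSubfield.isCMField_reflexField`): «an admissible reflex record is a SUB-corner of `(K, Ψ, ι₁ ∘ j)` at the lift type WITHOUT primitivity».
0 `proof-hole`; expected `#print axioms` ⊆ {propext, Classical.choice, Quot.sound}.
-/
import Summits.HodgeConjecture.HodgeCM.Model.LiuDictionary

/-! PORT of `HodgeCM/Model/LiuCMSideSubCorner.lean` (HodgeCMPerL run 82) — verbatim mechanical port; provenance in the PORT header line. -/

set_option autoImplicit false

noncomputable section

open scoped TensorProduct
open NumberField CategoryTheory Module
open Literature.AlgebraicGeometry.Motives (CMType AbelianVariety bettiCohomology SchemeOver)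
open Literature.AlgebraicGeometry.HodgeTheory
open Literature.AlgebraicGeometry.HodgeTheory.BettiUniverse (pull cmAction IsInducedOnIntegers)
open Literature.AlgebraicGeometry.ComplexMultiplication (IsCMTypeRealisation)
open Literature.NumberTheory.Automorphic.PicardCM
open HodgeCM.Literature.Theta HodgeCM.Literature.Theta.LiuAlbaneseModuleDatum

namespace HodgeCM

namespace Model

namespace LiuCMSide

/-- **The SUB-CORNER predicate** (pub-hodgecm2 own-b01's proposal, CM-typed so that the common pair can be realised): the corner type `Ψ`
of `K` and the record's type `Φ_A` of `C.M` are both INFLATED from one CM pair `(M', Φ')`, along `e₁ : M' → K` and `e₂ : M' → C.M`, with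
`σ ∘ e₁ = τ ∘ e₂`.  ([Liu21] Def. 4.3 ∕ 4.5 with `(M', Φ') = (M'_μ, Ψ_μ)` — the reflex pair — which maps to the corner field by an
ISOMORPHISM exactly when the corner type is primitive; in general only into it.) [folklore] -/
def IsSubCorner (C : LiuCMSide) (K : CMField) (Ψ : CMType K) (σ : K →+* ℂ) : Prop :=
  ∃ (M' : CMField) (Φ' : CMType M') (e₁ : M' →+* K) (e₂ : M' →+* C.M),
    (∀ τ : K →+* ℂ, τ ∈ Ψ.1 ↔ τ.comp e₁ ∈ Φ'.1) ∧ (∀ θ : C.M →+* ℂ, θ ∈ C.ΦA.1 ↔ θ.comp e₂ ∈ Φ'.1) ∧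
      σ.comp e₁ = C.τ.comp e₂

/-- A corner is a sub-corner (`M' := K`, `Φ' := Ψ`, `e₁ := id`, `e₂ := k ∘ e`). [folklore] -/
theorem isSubCorner_of_isCorner (C : LiuCMSide) {K : CMField} {Ψ : CMType K} {σ : K →+* ℂ} (h : C.IsCorner K Ψ σ) :
    C.IsSubCorner K Ψ σ := by
  obtain ⟨e, hΨ, hτ⟩ := h
  refine ⟨K, Ψ, RingHom.id K, C.k.comp e.toRingHom, fun τ => by rw [RingHom.comp_id], fun θ => ?_, ?_⟩
  · rw [C.hΦA θ, hΨ (θ.comp C.k), RingHom.comp_assoc]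
  · rw [RingHom.comp_id, ← RingHom.comp_assoc]
    exact hτ.symm

/-- **own-b01's shape ⇒ the sub-corner**: if the record's own reflex field `C.K'` is a CM NUMBER FIELD and `C.Φ'` a CM type of it (for an
ADMISSIBLE record both hold: `C.K' ≅` the reflex field of `(L, Φ_μ)` — CM by [Shimura1998 §8.3 Prop 28] ∕ [Streng2010 I.2.2 (d)], hub tree
`CMGaloisSubfield.isCMField_reflexField`, not yet vendored — and `C.Φ' ↔ reflexTypeC`, a CM type by this seat's #H13
`LiuCMSide.reflexTypeC_mem_iff_conjugate_notMem`), then an EMBEDDING `e : C.K' →+* K` inflating `C.Φ'` to `Ψ` with `σ ∘ e = τ ∘ k`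
(pub-hodgecm2 own-b01's proposed `IsSubCorner`, INBOX l.138 (1)) gives the sub-corner with `(M', Φ') := (C.K', C.Φ')`, `e₁ := e`, `e₂ := C.k`. [folklore] -/
theorem isSubCorner_of_embedding (C : LiuCMSide) [NumberField C.K'] [IsCMField C.K']
    (hΦ' : ∀ ψ : C.K' →+* ℂ, ψ ∈ C.Φ' ↔ NumberField.ComplexEmbedding.conjugate ψ ∉ C.Φ')
    {K : CMField} {Ψ : CMType K} {σ : K →+* ℂ}
    (e : C.K' →+* K) (hΨ : ∀ τ : K →+* ℂ, τ ∈ Ψ.1 ↔ τ.comp e ∈ C.Φ') (hσ : σ.comp e = C.τ.comp C.k) :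
    C.IsSubCorner K Ψ σ :=
  ⟨⟨C.K'⟩, ⟨C.Φ', hΦ'⟩, e, C.k, hΨ, C.hΦA, hσ⟩

/-- **The common-reflex datum of a sub-corner** (binder-1's `CommonReflexInput` filled field by field: `(M', Φ', e₁)` the common pair and its
map to the corner, `(C.M, e₂, C.ΦA)` the record's field and type, `(C.A, C.ιA, C.θA)` its abelian variety, `C.τ`). [folklore] -/
def commonReflexInputOfSubCorner (C : LiuCMSide) {K : CMField} {Ψ : CMType K} {σ : K →+* ℂ}
    (M' : CMField) (Φ' : CMType M') (e₁ : M' →+* K) (e₂ : M' →+* C.M)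
    (hΨ : ∀ τ : K →+* ℂ, τ ∈ Ψ.1 ↔ τ.comp e₁ ∈ Φ'.1) (hΦA : ∀ θ : C.M →+* ℂ, θ ∈ C.ΦA.1 ↔ θ.comp e₂ ∈ Φ'.1)
    (hστ : σ.comp e₁ = C.τ.comp e₂) : CommonReflexInput K Ψ σ where
  M' := M'
  Φ' := Φ'
  k₁ := e₁
  mem_iff := hΨ
  M := C.M
  k₂ := e₂
  ΦA := C.ΦA
  memA_iff := hΦA
  A := C.A
  ιA := C.ιA
  θA := C.θA
  isRealisation := C.isRealisation
  τ := C.τ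
  comp_eq := hστ.symm

/-- (Ported verbatim from the HodgeCMPerL package; no docstring in the source.) -/
@[simp] theorem commonReflexInputOfSubCorner_A (C : LiuCMSide) {K : CMField} {Ψ : CMType K} {σ : K →+* ℂ}
    (M' : CMField) (Φ' : CMType M') (e₁ : M' →+* K) (e₂ : M' →+* C.M)
    (hΨ : ∀ τ : K →+* ℂ, τ ∈ Ψ.1 ↔ τ.comp e₁ ∈ Φ'.1) (hΦA : ∀ θ : C.M →+* ℂ, θ ∈ C.ΦA.1 ↔ θ.comp e₂ ∈ Φ'.1)
    (hστ : σ.comp e₁ = C.τ.comp e₂) : (C.commonReflexInputOfSubCorner M' Φ' e₁ e₂ hΨ hΦA hστ).A = C.A := rfl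

variable (hHD : exists_isReal_hodgeModel) (hI : hodgePQ_independent_of_hodgeModel)
  (h₁ : BallQuotientUniformised) (h₃ : CMAbelianVarietyRealised)

/-- **`hJ5` from the SUB-corner predicate** — binder-2's `exists_commonReflexInput_of_isCorner` with the weaker hypothesis, same conclusion:
a `D : CommonReflexInput K Ψ σ` with `D.A = C.A` all of whose surface classes contain every `(f^*)_ℂ α`, `f : P_Γ ⟶ C.A` a `ℂ`-morphism, at
every level. [folklore] -/
theorem exists_commonReflexInput_of_isSubCorner (C : LiuCMSide) {K : CMField} {Ψ : CMType K} {σ : K →+* ℂ}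
    (h : C.IsSubCorner K Ψ σ) {L : CMField} {ι₁ : L →+* ℂ} (V : HermSpace3 L ι₁) :
    ∃ D : CommonReflexInput K Ψ σ, D.A = C.A ∧ ∀ (Γ : Level V)
      (f : (pmsRealisation (ballQuotientUniformisedDatum_of h₁) (pmsCode L ι₁ V Γ)).X ⟶ C.A.X),
      (pull f 1).baseChange ℂ C.α ∈ D.surfaceClasses hHD hI h₁ h₃ V Γ := by
  obtain ⟨M', Φ', e₁, e₂, hΨ, hΦA, hστ⟩ := h
  exact ⟨C.commonReflexInputOfSubCorner M' Φ' e₁ e₂ hΨ hΦA hστ, rfl, fun Γ f => ⟨f, C.α, C.α_mem, rfl⟩⟩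

end LiuCMSide

/-! ## Row 9 from ONE block and `Thm418C`, CM side by SUB-corners -/

section Dictionary

variable {hHD : exists_isReal_hodgeModel} {hI : hodgePQ_independent_of_hodgeModel}
  {h₁ : BallQuotientUniformised} {h₃ : CMAbelianVarietyRealised}
variable {L : CMField} {ι₁ : L →+* ℂ} {V : HermSpace3 L ι₁} (T : LiuDictionary hHD hI h₁ h₃ V)

/-- **ROW 9 FROM ONE BLOCK, SUB-CORNER FORM.**  If the combined reading `Thm418C` holds for the dictionary `T`, `μ` is a character with
`ι₁ ∈ Φ_μ` whose admissible CM records are SUB-corners of `(K, Ψ, σ)`, and every class of `Θ Γ` is the identity-component restriction of a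
`Γ.K`-fixed vector of the one block `block μ`, then below r8's threshold at `μ` the classes lie in the span of the common-reflex surface classes
of the corner `(K, Ψ, σ)`.  (This seat's #H7 `subset_span_of_block` with clause 2 weakened from `IsCorner` to `IsSubCorner`; same proof.)
[folklore] -/
theorem subset_span_of_block_of_isSubCorner (h418 : T.Thm418C)
    {K : CMField} {Ψ : CMType K} {σ : K →+* ℂ} (μ : T.Char) (hΦ : T.PhiMu μ)
    (hsub : ∀ d : LiuCMSide, T.adm μ d → d.IsSubCorner K Ψ σ)
    (Θ : ∀ Γ : Level V, Set ((picardCMUniverse hHD hI h₁ h₃).CohC ((picardCMUniverse hHD hI h₁ h₃).pms L ι₁ V Γ) 1))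
    (hIso : ∀ (Γ : Level V), ∀ ω ∈ Θ Γ, ∃ x : T.H, x ∈ fixedBy Γ.K T.H ∧ T.res Γ x = ω ∧ x ∈ T.block μ) :
    ∃ Γ₀ : Level V, ∀ Γ ≤ Γ₀,
      Θ Γ ⊆ Submodule.span ℂ (⋃ D : CommonReflexInput K Ψ σ, D.surfaceClasses hHD hI h₁ h₃ V Γ) := by
  obtain ⟨K₀, hK₀⟩ := h418 μ hΦ
  refine ⟨K₀, fun Γ hΓ ω hω => ?_⟩
  obtain ⟨x, hxfix, hxres, hxbl⟩ := hIso Γ ω hω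
  rw [← hxres]
  refine Submodule.span_mono ?_ (hK₀ Γ hΓ x hxbl hxfix)
  intro y hy
  simp only [LiuDictionary.cmClasses, Set.mem_iUnion, Set.mem_range] at hy
  obtain ⟨d, hd, f, rfl⟩ := hy
  obtain ⟨D, -, hD⟩ := d.exists_commonReflexInput_of_isSubCorner hHD hI h₁ h₃ (hsub d hd) V
  exact Set.mem_iUnion.2 ⟨D, hD Γ f⟩

/-- **… and straight into E's `Uiso`**: under `σ ∈ Ψ` and Riemann's fullness `hR`, the same classes lie in `Uiso Γ K Ψ σ` below the threshold
(binder-1's `span_classes_le_Uiso` per datum). [folklore] -/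
theorem subset_Uiso_of_block_of_isSubCorner (hR : DeligneMilne1982_Thm_6_20_full) (h418 : T.Thm418C)
    {K : CMField} {Ψ : CMType K} {σ : K →+* ℂ} (hσ : σ ∈ Ψ.1) (μ : T.Char) (hΦ : T.PhiMu μ)
    (hsub : ∀ d : LiuCMSide, T.adm μ d → d.IsSubCorner K Ψ σ)
    (Θ : ∀ Γ : Level V, Set ((picardCMUniverse hHD hI h₁ h₃).CohC ((picardCMUniverse hHD hI h₁ h₃).pms L ι₁ V Γ) 1))
    (hIso : ∀ (Γ : Level V), ∀ ω ∈ Θ Γ, ∃ x : T.H, x ∈ fixedBy Γ.K T.H ∧ T.res Γ x = ω ∧ x ∈ T.block μ) :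
    ∃ Γ₀ : Level V, ∀ Γ ≤ Γ₀, Θ Γ ⊆ (picardCMUniverse hHD hI h₁ h₃).Uiso Γ K Ψ σ := by
  obtain ⟨Γ₀, hΓ₀⟩ := subset_span_of_block_of_isSubCorner T h418 μ hΦ hsub Θ hIso
  refine ⟨Γ₀, fun Γ hΓ => (hΓ₀ Γ hΓ).trans ?_⟩
  refine Submodule.span_le.2 (Set.iUnion_subset fun D => ?_)
  exact Submodule.subset_span.trans (span_classes_le_Uiso hHD hI h₁ h₃ hR V Γ hσ D)

end Dictionary

end Model

end HodgeCM

end
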